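import Literature.NumberTheory.EllipticCurves.Kato2004.GeneratorChange
import Literature.NumberTheory.EllipticCurves.Kato2004.MainConjecturePrimeTDoorProofs
import Literature.NumberTheory.EllipticCurves.IwasawaTowerTorsionOrdinaryLocalProofs
import HarnessLib

/-!
# Kato 2004 Conj. 12.10 at `𝔭 = (T)` for `T_pW` at a door prime — the named fact
# `kato_mainConjecture_primeT_of_door` FOR EVERY CYCLOTOMIC PAIR `(K, γ)`, from its printed inputs
# (proofs only; companion of `MainConjecturePrimeTDoor.lean` and `MainConjecturePrimeTDoorProofs.lean`)

[M5 BirchSwinnertonDyer] (Literature support for the INPUT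
`Literature.NumberTheory.EllipticCurves.Kato2004.kato_mainConjecture_primeT_of_door`, item
stmt-BirchSwinnertonDyer-23168 = stub L2b of crux stmt-BirchSwinnertonDyer-23024, line `lower`, route
`DerivedKatoValuationDoor`; theorems only, no definition, no new named fact.)

`MainConjecturePrimeTDoorProofs.lean` assembled the printed proof (Burungale–Castella–Skinner 2025
Thm. 1.1.2 (a) + Kato §17.13, p. 280 + (14.9.1) + Imai 1975) in the kernel for the cyclotomic pair
`(K, γ)` IN THE CYCLOTOMIC VARIABLE (`IsCyclotomicVariable p γ`: the variable of `L_p(E,T)` in which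
BCS and the §17.13 package are stated), modulo the tree's named facts `hBCS`
(`burungale_castella_skinner_charIdeal_eq_padicLFunction`), `hH2`
(`exists_iwasawaH2Data_fineSelmerDual_embedding`), the pointwise Imai-local finiteness `hfin`, and ONE
typed missing clause `hX` (Kato's §17.13 package with fine quotient and the admissible localisation
clause `(K.Z)_𝔭 = (Λ z₀)_𝔭`, Thm. 12.6 + Thm. 12.5 (1)(4) — spelled out inline, not a named fact).
The named fact itself quantifies over EVERY cyclotomic datum `K : Γ_ℚ ↠ ℤ_p` and EVERY topological
generator `γ`.  This file removes the restriction by the change of datum/generator of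
`GeneratorChange.lean` (Washington §13.2: `ℤ_p⟦Γ⟧ ≅ ℤ_p⟦T⟧` up to `φ_u : T ↦ (1+T)^u − 1`, which fixes
`(T)`): `K = u • κ₀` for the normalised pair `(κ₀, γ₀)`
(`exists_isCyclotomic_isTopGenerator_isCyclotomicVariable_holds`, `IsCyclotomic.exists_eq_unitTwist_holds`);
the pinned `𝐇¹_Γ`, the admissible class and `X₀(E/ℚ_∞)` are transported to `(κ₀, γ₀)`
(`IwasawaH1Data.changeData`, `IsAdmissibleZetaClass.changeData`, `FineSelmerDualData.changeData`),
`hX` is applied THERE, and both `(T)`-lengths are invariant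
(`IwasawaH1Data.lengthAt_quotient_span_changeData_eq`, `FineSelmerDualData.lengthAt_changeData_primeT_eq`).

* `lengthAt_quotient_span_primeT_eq_fineSelmerDual_of_inputs'` — `ℓ_T(𝐇¹_Γ/Λz₀) = ℓ_T(X₀(E/ℚ_∞))`
  for every admissible `z₀`, every cyclotomic `K`, every topological generator `γ`, modulo
  `{hBCS, hX}`;
* `zetaQuotientLength_le_fineLength_of_inputs'` — the consumer's inequality (crux 23024, line
  `lower`) for all pairs, modulo `{hBCS, hX}`;
* `kato_mainConjecture_primeT_of_door_conclusion_of_inputs` — the conclusion `∃ J e, …` of the named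
  fact for all pairs, modulo `{hBCS, hX, hH2, hfin}`;
* `kato_mainConjecture_primeT_of_door_of_inputs` — **the named fact ITSELF from
  `{hBCS, hX, hH2, hImai}`**, `hImai` = Imai 1975 in the local currency of `hH2`
  (`E(ℚ_{p,∞})[p^∞]` finite for the cyclotomic tower at a good ordinary `p ≥ 5`);
* `kato_mainConjecture_primeT_of_door_of_bcs_of_clause_of_h2` — **the named fact from
  `{hBCS, hX, hH2}` only**: `hImai` is DISCHARGED by the tree theorem
  `WeierstrassCurve.finite_fixedPoints_kerSubgroup_inf_decomp_of_ordinary`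
  (file `IwasawaTowerTorsionOrdinaryLocalProofs`, Imai-local at a good ordinary odd prime).

HONEST FRAMING: the named fact is NOT discharged; what remains is exactly `hBCS` (BCS 2025, a named
fact of the tree), `hH2` (Kato (14.9.1) + (17.13.1), a named fact of the tree) and the typed clause `hX` (print: [Ka] Thm. 12.6 (p. 222), Thm. 12.5 (1)(4) (pp. 221–222),
§13.9–13.12 (pp. 229–231); not in the tree).  Nothing about BSD is claimed.

## References
* [Ka] K. Kato, *p-adic Hodge theory and values of zeta functions of modular forms*, Astérisque 295
  (2004): Conj. 12.10 (p. 224), Thm. 12.5 (pp. 221–222), Thm. 12.6 (p. 222), (14.9.1) (p. 239),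
  §17.13 (pp. 279–280). [Kato2004Asterisque]
* A. Burungale, F. Castella, C. Skinner, *Base change and Iwasawa main conjectures for GL₂*, IMRN 2025
  (arXiv:2405.00270v2), Thm. 1.1.2 (a). [BurungaleCastellaSkinner2025]
* H. Imai, Proc. Japan Acad. 51 (1975) 12–16, Theorem (p. 12). [Imai1975]
* L. C. Washington, *Introduction to Cyclotomic Fields*, GTM 83, §13.2. [Washington1997]
-/

noncomputable section

namespace Literature.NumberTheory.EllipticCurves.Kato2004

open scoped MatrixGroups ModularForm NumberField
open Field CongruenceSubgroup IsDedekindDomain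
open Literature.NumberTheory.GaloisRepresentations
open Literature.NumberTheory.EllipticCurves Literature.NumberTheory.EllipticCurves.ModularForms
open Literature.NumberTheory.EllipticCurves.Module Literature.NumberTheory.EllipticCurves.IwasawaAlgebra

section AllPairs

variable {p : ℕ} [Fact p.Prime]

/-- **`ℓ_T(𝐇¹_Γ/Λz₀) = ℓ_T(X₀(E/ℚ_∞))` for every admissible Kato zeta class, at a door prime, for EVERY
cyclotomic datum `K` and EVERY topological generator `γ`** — from `hBCS` and `hX` as in
`lengthAt_quotient_span_primeT_eq_fineSelmerDual_of_inputs` (which needs `γ` in the cyclotomic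
variable): `K = u • κ₀` for the normalised pair `(κ₀, γ₀)`
(`exists_isCyclotomic_isTopGenerator_isCyclotomicVariable_holds`, `IsCyclotomic.exists_eq_unitTwist_holds`),
and both sides are unchanged under the change of datum/generator `φ_u` (file `GeneratorChange`:
`IsAdmissibleZetaClass.changeData`, `IwasawaH1Data.lengthAt_quotient_span_changeData_eq`,
`FineSelmerDualData.lengthAt_changeData_primeT_eq`), `hX` being applied to the transported data over
`(κ₀, γ₀)`. [cite: Kato2004Asterisque, Conj. 12.10 (p. 224), §17.13 (pp. 279–280), Thm. 12.6 (p. 222)]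
[cite: BurungaleCastellaSkinner2025, Thm. 1.1.2 (a)] [cite: Washington1997, §13.2] -/
theorem lengthAt_quotient_span_primeT_eq_fineSelmerDual_of_inputs'
    (hBCS : burungale_castella_skinner_charIdeal_eq_padicLFunction)
    (hX : ∀ (W : WeierstrassCurve ℚ) [W.IsElliptic] [W.IsGloballyMinimal] (p : ℕ) [Fact p.Prime]
      [ContinuousSMul ℤ_[p] (W.tateModule p)] {N : ℕ} [NeZero N] (f : CuspForm (Gamma0 N) 2)
      (κ : ZpExtension ℚ p) (γ : absoluteGaloisGroup ℚ) (hκ : κ.IsCyclotomic),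
      p ≠ 2 → IsOrdinaryAt W p → κ.IsTopGenerator γ → IsCyclotomicVariable p γ → IsNewformOf W f →
      ∀ (I : IwasawaH1Data W p κ γ) (D : W.SelmerDualData κ γ) (Y : W.FineSelmerDualData κ γ),
        ∃ (K : DivisibilityInputs W p f κ γ I D) (π : D.X →ₗ[IwasawaAlgebra p] Y.X),
          Function.Surjective π ∧ Function.Exact K.toX π ∧
          (W.HasIrreducibleModPGaloisRep p → ∀ z₀ : I.H, IsAdmissibleZetaClass W p κ hκ I z₀ →
            ∀ 𝔭 : PrimeSpectrum (IwasawaAlgebra p), 𝔭.asIdeal.height = 1 →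
              ∃ s : IwasawaAlgebra p, s ∉ 𝔭.asIdeal ∧ s • z₀ ∈ K.Z ∧
                ∀ z ∈ K.Z, s • z ∈ Submodule.span (IwasawaAlgebra p) {z₀}))
    (W : WeierstrassCurve ℚ) [W.IsElliptic] [W.IsGloballyMinimal] [ContinuousSMul ℤ_[p] (W.tateModule p)]
    (h5 : 5 ≤ p) (hord : IsOrdinaryAt W p) (hsurj : W.HasSurjectiveModNGaloisRep p)
    (K : ZpExtension ℚ p) (hK : K.IsCyclotomic) (γ : absoluteGaloisGroup ℚ) (hγ : K.IsTopGenerator γ)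
    (I : IwasawaH1Data W p K γ) {z₀ : I.H} (hz : IsAdmissibleZetaClass W p K hK I z₀) :
    lengthAt (IwasawaAlgebra p) (I.H ⧸ Submodule.span (IwasawaAlgebra p) {z₀}) (primeT p) =
      lengthAt (IwasawaAlgebra p) (W.fineSelmerDualData K hγ).X (primeT p) := by
  -- the normalised pair and `K = u • κ₀`
  obtain ⟨κ₀, hκ₀, γ₀, hγ₀, hγ₀'⟩ := exists_isCyclotomic_isTopGenerator_isCyclotomicVariable_holds p
  obtain ⟨c, rfl⟩ := ZpExtension.IsCyclotomic.exists_eq_unitTwist_holds (κ := κ₀) hκ₀ hK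
  have hirr : W.HasIrreducibleModPGaloisRep p := hasIrreducibleModPGaloisRep_of_door W hsurj
  letI : Module.Free ℤ_[p] (W.tateModule p) := W.module_free_tateModule_holds p
  letI : Module.Finite ℤ_[p] (W.tateModule p) := W.module_finite_tateModule_holds p
  -- transport the admissible class to the datum over `(κ₀, γ₀)`
  have hz₀ : IsAdmissibleZetaClass W p κ₀ hκ₀ (I.changeData κ₀ c hγ hγ₀)
      (show (I.changeData κ₀ c hγ hγ₀).H from z₀) :=
    IsAdmissibleZetaClass.changeData κ₀ c I hγ hγ₀ hK hκ₀ hz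
  obtain ⟨hp2, N, hN, f, hf, -⟩ := (isAdmissibleZetaClass_iff W p κ₀ hκ₀ _ _).mp hz₀
  -- the package with fine quotient onto the TRANSPORTED `X₀`, and its localisation clause
  obtain ⟨Kp, π, hπs, hπ, hloc⟩ := hX W p f κ₀ γ₀ hκ₀ hp2 hord hγ₀ hγ₀' hf (I.changeData κ₀ c hγ hγ₀)
    (W.selmerDualData κ₀ hγ₀) ((W.fineSelmerDualData (κ₀.unitTwist c) hγ).changeData κ₀ c hγ hγ₀)
  have hcore := lengthAt_quotient_span_primeT_eq_fine_of_bcs hBCS h5 hord hirr hκ₀ hγ₀ hγ₀' hf Kp π hπs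
    hπ (hloc hirr _ hz₀ (primeT p) (height_primeT p))
  exact (IwasawaH1Data.lengthAt_quotient_span_changeData_eq κ₀ c I hγ hγ₀ z₀).symm.trans
    (hcore.trans (WeierstrassCurve.FineSelmerDualData.lengthAt_changeData_primeT_eq κ₀ c _ hγ hγ₀))

/-- **The consumer's inequality for ALL cyclotomic pairs, modulo `hBCS` and `hX` only**: at a door
prime, for every cyclotomic `K`, every topological generator `γ`, every pinned `I` and every admissible
`z₀`, `ℓ_T(𝐇¹_Γ/Λz₀) ≤ ℓ_T(X₀(E/ℚ_∞))` — verbatim the conclusion of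
`Summit…DerivedKatoValuationDoor.zetaQuotientLengthLeFineLength_of_stub` (crux 23024, line `lower`);
indeed `=`. [cite: Kato2004Asterisque, Conj. 12.10 (p. 224), §17.13 (p. 280)]
[cite: BurungaleCastellaSkinner2025, Thm. 1.1.2 (a)] -/
theorem zetaQuotientLength_le_fineLength_of_inputs'
    (hBCS : burungale_castella_skinner_charIdeal_eq_padicLFunction)
    (hX : ∀ (W : WeierstrassCurve ℚ) [W.IsElliptic] [W.IsGloballyMinimal] (p : ℕ) [Fact p.Prime]
      [ContinuousSMul ℤ_[p] (W.tateModule p)] {N : ℕ} [NeZero N] (f : CuspForm (Gamma0 N) 2)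
      (κ : ZpExtension ℚ p) (γ : absoluteGaloisGroup ℚ) (hκ : κ.IsCyclotomic),
      p ≠ 2 → IsOrdinaryAt W p → κ.IsTopGenerator γ → IsCyclotomicVariable p γ → IsNewformOf W f →
      ∀ (I : IwasawaH1Data W p κ γ) (D : W.SelmerDualData κ γ) (Y : W.FineSelmerDualData κ γ),
        ∃ (K : DivisibilityInputs W p f κ γ I D) (π : D.X →ₗ[IwasawaAlgebra p] Y.X),
          Function.Surjective π ∧ Function.Exact K.toX π ∧
          (W.HasIrreducibleModPGaloisRep p → ∀ z₀ : I.H, IsAdmissibleZetaClass W p κ hκ I z₀ →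
            ∀ 𝔭 : PrimeSpectrum (IwasawaAlgebra p), 𝔭.asIdeal.height = 1 →
              ∃ s : IwasawaAlgebra p, s ∉ 𝔭.asIdeal ∧ s • z₀ ∈ K.Z ∧
                ∀ z ∈ K.Z, s • z ∈ Submodule.span (IwasawaAlgebra p) {z₀}))
    (W : WeierstrassCurve ℚ) [W.IsElliptic] [W.IsGloballyMinimal] [ContinuousSMul ℤ_[p] (W.tateModule p)]
    (h5 : 5 ≤ p) (hord : IsOrdinaryAt W p) (hsurj : W.HasSurjectiveModNGaloisRep p)
    (K : ZpExtension ℚ p) (hK : K.IsCyclotomic) (γ : absoluteGaloisGroup ℚ) (hγ : K.IsTopGenerator γ)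
    (I : IwasawaH1Data W p K γ) (z₀ : I.H) (hz : IsAdmissibleZetaClass W p K hK I z₀) :
    lengthAt (IwasawaAlgebra p) (I.H ⧸ Submodule.span (IwasawaAlgebra p) {z₀}) (primeT p) ≤
      lengthAt (IwasawaAlgebra p) (W.fineSelmerDualData K hγ).X (primeT p) :=
  (lengthAt_quotient_span_primeT_eq_fineSelmerDual_of_inputs' hBCS hX W h5 hord hsurj K hK γ hγ I hz).le

/-- A door prime is odd (private helper). [folklore] -/
private theorem ne_two_of_five_le' (hp : 5 ≤ p) : p ≠ 2 := by
  rintro rfl; omega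

/-- **The conclusion of `kato_mainConjecture_primeT_of_door` for EVERY cyclotomic pair `(K, γ)`**, from
`hBCS`, `hX`, `hH2` (`exists_iwasawaH2Data_fineSelmerDual_embedding`) and the pointwise Imai-local
finiteness `hfin` — `kato_mainConjecture_primeT_of_door_of_isCyclotomicVariable` with its restriction
`IsCyclotomicVariable p γ` REMOVED by the change of datum/generator.
[cite: Kato2004Asterisque, Conj. 12.10 (p. 224), §17.13 (pp. 279–280), (14.9.1) (p. 239), Thm. 12.6 (p. 222)]
[cite: BurungaleCastellaSkinner2025, Thm. 1.1.2 (a)] [cite: Imai1975, Theorem (p. 12)]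
[cite: Washington1997, §13.2] -/
theorem kato_mainConjecture_primeT_of_door_conclusion_of_inputs
    (hBCS : burungale_castella_skinner_charIdeal_eq_padicLFunction)
    (hX : ∀ (W : WeierstrassCurve ℚ) [W.IsElliptic] [W.IsGloballyMinimal] (p : ℕ) [Fact p.Prime]
      [ContinuousSMul ℤ_[p] (W.tateModule p)] {N : ℕ} [NeZero N] (f : CuspForm (Gamma0 N) 2)
      (κ : ZpExtension ℚ p) (γ : absoluteGaloisGroup ℚ) (hκ : κ.IsCyclotomic),
      p ≠ 2 → IsOrdinaryAt W p → κ.IsTopGenerator γ → IsCyclotomicVariable p γ → IsNewformOf W f →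
      ∀ (I : IwasawaH1Data W p κ γ) (D : W.SelmerDualData κ γ) (Y : W.FineSelmerDualData κ γ),
        ∃ (K : DivisibilityInputs W p f κ γ I D) (π : D.X →ₗ[IwasawaAlgebra p] Y.X),
          Function.Surjective π ∧ Function.Exact K.toX π ∧
          (W.HasIrreducibleModPGaloisRep p → ∀ z₀ : I.H, IsAdmissibleZetaClass W p κ hκ I z₀ →
            ∀ 𝔭 : PrimeSpectrum (IwasawaAlgebra p), 𝔭.asIdeal.height = 1 →
              ∃ s : IwasawaAlgebra p, s ∉ 𝔭.asIdeal ∧ s • z₀ ∈ K.Z ∧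
                ∀ z ∈ K.Z, s • z ∈ Submodule.span (IwasawaAlgebra p) {z₀}))
    (hH2 : exists_iwasawaH2Data_fineSelmerDual_embedding)
    (W : WeierstrassCurve ℚ) [W.IsElliptic] [W.IsGloballyMinimal] [ContinuousSMul ℤ_[p] (W.tateModule p)]
    (h5 : 5 ≤ p) (hord : IsOrdinaryAt W p) (hsurj : W.HasSurjectiveModNGaloisRep p)
    (K : ZpExtension ℚ p) (hK : K.IsCyclotomic) (γ : absoluteGaloisGroup ℚ) (hγ : K.IsTopGenerator γ)
    (v : HeightOneSpectrum (𝓞 ℚ)) (hv : ((Rat.HeightOneSpectrum.primesEquiv v : Nat.Primes) : ℕ) = p)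
    (hfin : Finite (FixedPoints.addSubgroup ↥(K.kerSubgroup ⊓ GreenbergSelmer.decomp v)
      (W.geomPrimaryTorsion p)))
    (I : IwasawaH1Data W p K γ) :
    ∃ (J : IwasawaH2Data W p K γ I)
      (e : (W.fineSelmerDualData K hγ).X →ₗ[IwasawaAlgebra p] J.H2),
      Function.Injective e ∧ Finite (J.H2 ⧸ LinearMap.range e) ∧
      ∀ z₀ : I.H, IsAdmissibleZetaClass W p K hK I z₀ →
        lengthAt (IwasawaAlgebra p) J.H2 (primeT p) =
          lengthAt (IwasawaAlgebra p) (I.H ⧸ Submodule.span (IwasawaAlgebra p) {z₀}) (primeT p) := by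
  obtain ⟨J, e, he, hfin'⟩ := hH2 W p K γ hγ v (ne_two_of_five_le' h5) hK hv hfin I
  refine ⟨J, e, he, hfin', fun z₀ hz ↦ ?_⟩
  have hX₀ : lengthAt (IwasawaAlgebra p) (W.fineSelmerDualData K hγ).X (primeT p) =
      lengthAt (IwasawaAlgebra p) J.H2 (primeT p) :=
    lengthAt_eq_of_injective_of_finite_quotient e he hfin' (primeT p) (height_primeT p).le
  rw [← hX₀, lengthAt_quotient_span_primeT_eq_fineSelmerDual_of_inputs' hBCS hX W h5 hord hsurj K hK γ
    hγ I hz]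

end AllPairs

/-- **The named fact `kato_mainConjecture_primeT_of_door` ITSELF, from its four printed inputs**:
`hBCS` (Burungale–Castella–Skinner 2025 Thm. 1.1.2 (a), tree named fact), `hX` (Kato's §17.13 package
with fine quotient and the admissible localisation clause, Thm. 12.6 + 12.5 (1)(4) — the typed «needs X»
of this input), `hH2` (Kato (14.9.1) + (17.13.1): tree named fact
`exists_iwasawaH2Data_fineSelmerDual_embedding`) and `hImai` (Imai 1975 in the local currency of `hH2`:
`E(ℚ_{p,∞})[p^∞]` finite at a good ordinary `p ≥ 5`, for the cyclotomic tower). Nothing about BSD is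
claimed. [cite: Kato2004Asterisque, Conj. 12.10 (p. 224), §17.13 (pp. 279–280)]
[cite: BurungaleCastellaSkinner2025, Thm. 1.1.2 (a)] [cite: Imai1975, Theorem (p. 12)] -/
theorem kato_mainConjecture_primeT_of_door_of_inputs
    (hBCS : burungale_castella_skinner_charIdeal_eq_padicLFunction)
    (hX : ∀ (W : WeierstrassCurve ℚ) [W.IsElliptic] [W.IsGloballyMinimal] (p : ℕ) [Fact p.Prime]
      [ContinuousSMul ℤ_[p] (W.tateModule p)] {N : ℕ} [NeZero N] (f : CuspForm (Gamma0 N) 2)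
      (κ : ZpExtension ℚ p) (γ : absoluteGaloisGroup ℚ) (hκ : κ.IsCyclotomic),
      p ≠ 2 → IsOrdinaryAt W p → κ.IsTopGenerator γ → IsCyclotomicVariable p γ → IsNewformOf W f →
      ∀ (I : IwasawaH1Data W p κ γ) (D : W.SelmerDualData κ γ) (Y : W.FineSelmerDualData κ γ),
        ∃ (K : DivisibilityInputs W p f κ γ I D) (π : D.X →ₗ[IwasawaAlgebra p] Y.X),
          Function.Surjective π ∧ Function.Exact K.toX π ∧
          (W.HasIrreducibleModPGaloisRep p → ∀ z₀ : I.H, IsAdmissibleZetaClass W p κ hκ I z₀ →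
            ∀ 𝔭 : PrimeSpectrum (IwasawaAlgebra p), 𝔭.asIdeal.height = 1 →
              ∃ s : IwasawaAlgebra p, s ∉ 𝔭.asIdeal ∧ s • z₀ ∈ K.Z ∧
                ∀ z ∈ K.Z, s • z ∈ Submodule.span (IwasawaAlgebra p) {z₀}))
    (hH2 : exists_iwasawaH2Data_fineSelmerDual_embedding)
    (hImai : ∀ (W : WeierstrassCurve ℚ) [W.IsElliptic] [W.IsGloballyMinimal] (p : ℕ) [Fact p.Prime],
      5 ≤ p → IsOrdinaryAt W p → ∀ (K : ZpExtension ℚ p), K.IsCyclotomic →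
        ∀ (v : HeightOneSpectrum (𝓞 ℚ)), ((Rat.HeightOneSpectrum.primesEquiv v : Nat.Primes) : ℕ) = p →
          Finite (FixedPoints.addSubgroup ↥(K.kerSubgroup ⊓ GreenbergSelmer.decomp v)
            (W.geomPrimaryTorsion p))) :
    kato_mainConjecture_primeT_of_door := by
  intro W _ _ p _ _ h5 hord hsurj K hK γ hγ I
  -- the place of `ℚ` above `p`
  set v : HeightOneSpectrum (𝓞 ℚ) :=
    Rat.HeightOneSpectrum.primesEquiv.symm ⟨p, (Fact.out : p.Prime)⟩ with hv_def
  have hv : ((Rat.HeightOneSpectrum.primesEquiv v : Nat.Primes) : ℕ) = p := by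
    rw [hv_def, Equiv.apply_symm_apply]
  exact kato_mainConjecture_primeT_of_door_conclusion_of_inputs hBCS hX hH2 W h5 hord hsurj K hK γ hγ v
    hv (hImai W p h5 hord K hK v hv) I


/-- **The named fact `kato_mainConjecture_primeT_of_door` from `{hBCS, hX, hH2}` ONLY** — the Imai
input of `kato_mainConjecture_primeT_of_door_of_inputs` DISCHARGED by
`WeierstrassCurve.finite_fixedPoints_kerSubgroup_inf_decomp_of_ordinary` (`E(ℚ_{p,∞})[p^∞]` is finite
for the cyclotomic tower at a good ordinary odd `p`; a door prime is `≥ 5` and `IsOrdinaryAt` is good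
ordinary reduction). What remains: BCS 2025 Thm. 1.1.2 (a) (`hBCS`, tree named fact), Kato's
`𝐇² ⊇ X₀` comparison (`hH2`, tree named fact) and the typed §17.13/Thm. 12.6 clause `hX`. Nothing about
BSD is claimed. [cite: Kato2004Asterisque, Conj. 12.10 (p. 224), §17.13 (pp. 279–280)]
[cite: BurungaleCastellaSkinner2025, Thm. 1.1.2 (a)] [cite: Imai1975, Theorem (p. 12)]
[cite: GreenbergLNM1716, §1 p. 62] -/
theorem kato_mainConjecture_primeT_of_door_of_bcs_of_clause_of_h2
    (hBCS : burungale_castella_skinner_charIdeal_eq_padicLFunction)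
    (hX : ∀ (W : WeierstrassCurve ℚ) [W.IsElliptic] [W.IsGloballyMinimal] (p : ℕ) [Fact p.Prime]
      [ContinuousSMul ℤ_[p] (W.tateModule p)] {N : ℕ} [NeZero N] (f : CuspForm (Gamma0 N) 2)
      (κ : ZpExtension ℚ p) (γ : absoluteGaloisGroup ℚ) (hκ : κ.IsCyclotomic),
      p ≠ 2 → IsOrdinaryAt W p → κ.IsTopGenerator γ → IsCyclotomicVariable p γ → IsNewformOf W f →
      ∀ (I : IwasawaH1Data W p κ γ) (D : W.SelmerDualData κ γ) (Y : W.FineSelmerDualData κ γ),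
        ∃ (K : DivisibilityInputs W p f κ γ I D) (π : D.X →ₗ[IwasawaAlgebra p] Y.X),
          Function.Surjective π ∧ Function.Exact K.toX π ∧
          (W.HasIrreducibleModPGaloisRep p → ∀ z₀ : I.H, IsAdmissibleZetaClass W p κ hκ I z₀ →
            ∀ 𝔭 : PrimeSpectrum (IwasawaAlgebra p), 𝔭.asIdeal.height = 1 →
              ∃ s : IwasawaAlgebra p, s ∉ 𝔭.asIdeal ∧ s • z₀ ∈ K.Z ∧
                ∀ z ∈ K.Z, s • z ∈ Submodule.span (IwasawaAlgebra p) {z₀}))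
    (hH2 : exists_iwasawaH2Data_fineSelmerDual_embedding) :
    kato_mainConjecture_primeT_of_door :=
  kato_mainConjecture_primeT_of_door_of_inputs hBCS hX hH2 fun W _ _ p _ h5 hord K hK v hv ↦
    W.finite_fixedPoints_kerSubgroup_inf_decomp_of_ordinary K (ne_two_of_five_le' h5)
      ((isOrdinaryAt_iff W p).mp hord).1 ((isOrdinaryAt_iff W p).mp hord).2 hK v hv

end Literature.NumberTheory.EllipticCurves.Kato2004

end
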